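import Summits.KontsevichZagierPeriods.KontsevichZagierPeriods.Theorems.FiveTermTransfer.Negative.Algebraicity


/-!
# Disproof of `ZagierDilogarithmConjecture` (stmt-KontsevichZagierPeriods-10550) — standing adversary, cycles 1–2

**Verdict so far: the crux RESISTS.** It is a faithful formalisation (volume / `ℤ`-form) of
Zagier's conjecture on `ℚ`-linear relations among Bloch–Wigner values at algebraic arguments
(Neumann 1998 §2.1; `vol` injective on `𝒫(ℚ̄)⁻`), an open conjecture believed true (its
cyclotomic case is Milnor's conjecture; on the Bloch group it is regulator injectivity for ONE
embedding, far beyond Borel). A kill needs an integer relation `Σ nᵢ D(zᵢ) = 0`, `zᵢ ∈ ℚ̄ ∩ ℍ⁺`,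
outside the five-term span; none is known and our numerics (kit job j010735, §8) found none.
Everything below is sorry-free, axioms ⊆ {propext, Classical.choice, Quot.sound}.

Findings (section numbers refer to the file):

0. `crux_iff` — the route decl (binder `∀ T, (∀ z, T z = {…}) → …`) is EQUIVALENT to the
   Literature conjecture `ZagierDilogarithmRelationsConjecture` (`idealTetrahedron`,
   `idealTetrahedronVolume`, `dilogRelators`); all variants below are stated in that vocabulary.
1. `idealTetrahedron_eq_empty_of_im_nonpos` — for `Im z ≤ 0` the region `T(z)` is EMPTY, so the
   set integral is an honest `0` (no Bochner junk anywhere: for `Im z > 0` the tree proves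
   integrability and `0 < vol T(z)`). READ-BACK: `T(z)` = open triangle `(0,1,z)` × `{t > 0}`
   above the hemisphere through `0, 1, z` = the ideal tetrahedron `(∞,0,1,z)`, density
   `dx dy dt/t³`; relators = five-term (Suslin–Neumann form, algebraic entries), `[w] + [w̄]`
   (`w` algebraic), `[w]` (`w` real); conclusion = membership in their `ℤ`-span.
   SOURCE CHECK (Neumann 1998 = arXiv:math/9712226, materialised): the pre-Bloch group is
   `ℤ⟨ℂ−{0,1}⟩/(five-term)` with EXACTLY this five-term form (p. 6, eq. (5term)); Thm 2.10
   (Suslin): `𝒫(ℂ)`, `ℬ(ℂ)` uniquely divisible, `ℬ(k)` uniquely divisible when `k ⊇` an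
   algebraically closed field, `ℬ(ℚ̄) → ℬ(ℂ)` injective (p. 7); the conjecture: "any rational
   linear relation among values of `D₂` at algebraic arguments must be a consequence of
   `D₂(z) = [−]D₂(z̄)` and the five-term functional relation … the volume map is injective on
   `𝒫(ℚ̄)⁻`" (pp. 7–8). So the item is the printed conjecture, in `ℤ`-form.
   `ℤ`-SPAN vs `ℚ`-SPAN: equivalent iff `ℤ[ℚ̄]/span ≅ 𝒫(ℚ̄)⁻` is torsion-free, which follows from
   the unique divisibility of `𝒫(ℚ̄)` (`ℬ(ℚ̄) ↪ ℬ(ℂ)` uniquely divisible; `Λ²ℚ̄ˣ` is a `ℚ`-space;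
   `K₂(ℚ̄) = 0`, so `𝒫(ℚ̄) ↪ 𝒫(ℂ)`); a torsion loophole would need a `ℚ/ℤ`-valued invariant of
   the span — none is computable (`Hom(𝒫(ℚ̄), ℤ/n) = 0` by divisibility). Not a kill.
2. `idealTetrahedronVolume_one_sub_conj` — MIRROR SYMMETRY `vol T(1 − z̄) = vol T(z)` for every
   `z` (the reflection `x ↦ 1 − x` of `ℍ³` is Lebesgue-measure-preserving, `reflEquiv`).
3. LOAD-BEARING `IsAlgebraic ℚ (z i)`: `zagier_false_without_algebraic` — witness the mirror pair
   `[L + i] − [(1 − L) + i]` (`L` Liouville's constant): volume sum `0`, coefficient `1` at the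
   transcendental point, where every relator has coefficient `0` (`coeffAt`).
4. REFUTED NAIVE STRENGTHENINGS: `not_volume_injective` (`vol T(i) = vol T(1+i)`, so the value
   relations are NOT trivial and the relators are needed) and LOAD-BEARING five-term family:
   `zagier_false_without_fiveTerm` (with only `[w]+[w̄]`, `[real]` the mirror relation is
   unexplained: signed coefficient at `±i`).
5. A DEHN-TYPE INVARIANT `dehn u v : ℤ[ℂ] →+ ℚ`, `[z] ↦ ψ(z) = φ(z) − φ(z̄)`,
   `φ(z) = u(z)v(1−z) − v(z)u(1−z)` for additive characters `u, v : ℂˣ → ℚ` (an alternating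
   pairing on the Bloch symbol `z ∧ (1−z)`, anti-symmetrised under conjugation): it kills EVERY
   dilogarithm relator — the five-term identity `sym_fiveTerm` holds exactly for all
   `x ≠ y ∈ ℂ ∖ {0,1}` (`ring` after the four field identities `fiveTerm_args`), `[w]+[w̄]` and
   `[real]` die by anti-symmetry. Characters with prescribed values exist by the injectivity of
   `ℚ` (`exists_addMonoidHom_eq_one_eq_zero`, Baer). WITNESS `q = (2+i)/(2−i) = (3+4i)/5`
   (unimodular, NOT a root of unity: `(2+i)ⁿ ≠ (2−i)ⁿ` by coprimality in `ℤ[i]`,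
   `gaussInt_pow_ne`), `z₀ = 1 − q = (2−4i)/5`: with `u(z₀) = 1, u(q) = 0, v(q) = 1, v(z₀) = 0`
   one gets `δ[z₀] = 2`, `δ[z̄₀] = −2` (`asym_z₀`), hence
   `of_z₀_not_mem`, `of_conj_z₀_not_mem : [(2 ∓ 4i)/5] ∉ AddSubgroup.closure dilogRelators`.
6. LOAD-BEARING `0 < Im zᵢ`: `zagier_false_without_posIm` (witness `z₀`, `T(z₀) = ∅`, `δ = 2`);
   LOAD-BEARING volume hypothesis / NON-VACUITY of the conclusion:
   `zagier_false_without_volumeHyp` — the relator span is a PROPER subgroup on the algebraic upper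
   half plane (`[(2+4i)/5]` is outside). So the crux has genuine content on both sides.
7. STRENGTH: `crux_implies_indep` — any proof of the crux proves that `vol T((2+4i)/5)` and
   `vol T(i) = G` (Catalan) are `ℤ`-independent, i.e. `D((2+4i)/5)/G ∉ ℚ`, an open irrationality
   statement (Neumann 1998 §1: not a single such volume is known to be irrational). This is the
   cheapest instance of what the conjecture asserts beyond the Dehn invariant (`δ[i] = 0`,
   `asym_I`): on `ker δ` (the Bloch group part) only transcendence methods can decide.
8. NUMERICS (kit job j010735, GP, 420 digits; results recorded in NOTES/evidence when returned):
   exact rank of `λ⁻` on Gaussian rationals of small height vs `lindep` on their Bloch–Wigner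
   values + `G`; theorem-level check that kernel combinations are rational multiples of `G`
   (Borel rank 1 + Suslin); cross-field independence of `|d|^{3/2} L(χ_d, 2)`; Milnor per `N ≤ 48`.
9. WHY IT RESISTS: off `ker δ` every relation is excluded ALGEBRAICALLY (this file); on `ker δ`
   (`ℬ(ℚ̄)⁻ ⊗ ℚ`, e.g. `[i]`, roots of unity, `[z]+[1−z]`-type combinations) the statement is
   single-embedding regulator injectivity — implied by the period conjecture for mixed Tate
   motives over `ℚ̄`, with no known counterexample and no proof technique; a refutation would be a
   sensational transcendence result in the negative. Dropping ANY hypothesis or the five-term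
   family makes it false (§3, §4, §6), so the statement is tight as filed.

10. LOAD-BEARING conjugation family (§8, cycle 2): `zagier_false_without_conjFamily` — with the
   relators `[w] + [w̄]` deleted (five-term + real kept) the mirror relation
   `vol T(4+i) = vol T(−3+i)` is unexplained: the PLAIN symbol `sym u v` for characters `u, v`
   vanishing on the positive reals kills five-term and real relators but gives `2` on
   `[4+i] − [−3+i]` (`z₁/z̄₁ = (4+i)/(4−i)` and `(1−z₁)/(1−z̄₁) = i·q⁻¹` are multiplicatively
   independent: coprimality of `4+i` with `4−i`, `2±i` in `ℤ[i]`). So BOTH non-trivial relator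
   families and ALL THREE hypotheses are load-bearing: the statement is tight in every coordinate
   (the real family `[w]` is redundant up to 2-torsion, `2[r] = [r] + [r̄]`, not pursued).

LANDED in the tree (`Theorems/ZagierDilogarithmConjecture/Negative/`, namespace
`Summit.KontsevichZagierPeriods.HyperbolicBloch.ZagierDilogarithmConjectureNegative`, all accepted):
`Mirror` (p78208: §0–§4), `DehnInvariant` (p76802: §5 generic), `DehnWitness` (p77123: §5 witness),
`LoadBearing` (p81376: §6–§7), `ConjChars` (p77363: §8 characters), `ConjFamily` (p81526: §8
witness) — importable by ideators/planners; this work file is their concatenation.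

Open questions for later cycles: the `ℚ(√−3)` sector numerics (job j011365); "Zagier over `ℂ`"
(false by Dehn–volume independence, but an exact equal-volume transcendental pair needs an IVT on
`z ↦ vol T(z)`); a torsion audit of the real family.
-/

noncomputable section

open Complex MeasureTheory Set
open scoped ComplexConjugate

set_option linter.dupNamespace false -- crux work-file namespace repeats the summit name

namespace Summit.KontsevichZagierPeriods.KontsevichZagierPeriods.Cruxes.ZagierDilogarithmConjecture.Disproof

open Literature.NumberTheory.Transcendental
open Summit.KontsevichZagierPeriods.KontsevichZagierPeriods.Theses.HyperbolicBloch
  (ZagierDilogarithmConjecture)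
open Summit.KontsevichZagierPeriods.HyperbolicBloch.FiveTermTransferNegative
  (L not_isAlgebraic_L xL xL_re xL_im not_isAlgebraic_xL isAlgebraic_of_eq_rat)

/-! ## §0 The crux is the Literature conjecture `ZagierDilogarithmRelationsConjecture` -/

/-- **Unfolding.** The route decl (binder `∀ T, (∀ z, T z = {…}) → …`) is equivalent to the named
Literature conjecture stated with `idealTetrahedron`, `idealTetrahedronVolume`, `dilogRelators`.
[cite: Neumann1998, §2.1 end (pp. 393–394): Zagier's conjecture] -/
theorem crux_iff : ZagierDilogarithmConjecture ↔ ZagierDilogarithmRelationsConjecture := by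
  constructor
  · intro h
    exact ZagierDilogarithmRelationsConjecture.of_inline idealTetrahedron (fun _ => rfl)
      (h idealTetrahedron (fun _ => rfl))
  · intro h T hT
    exact h.inline T hT

/-! ## §1 Degenerate parameters: `T(z) = ∅` off the upper half plane -/

/-- For `Im z ≤ 0` the region `T(z)` is EMPTY (the two edge inequalities through `z` force
`p 1 < Im z`): the lower half plane and the real line carry no solid, so their "volume" is the
honest `0`, not Bochner junk. This is why the crux quantifies `0 < Im zᵢ` and why the
sign convention `B(w̄) = −B(w)` of `FiveTermTransfer` is needed. [folklore] -/
theorem idealTetrahedron_eq_empty_of_im_nonpos {z : ℂ} (hz : z.im ≤ 0) :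
    idealTetrahedron z = ∅ := by
  ext p
  simp only [mem_idealTetrahedron_iff, mem_empty_iff_false, iff_false]
  rintro ⟨h1, h2, h3, -, -⟩
  nlinarith

/-- Hence the volume functional vanishes identically off the upper half plane. [folklore] -/
theorem idealTetrahedronVolume_eq_zero_of_im_nonpos {z : ℂ} (hz : z.im ≤ 0) :
    idealTetrahedronVolume z = 0 := by
  simp [idealTetrahedronVolume, idealTetrahedron_eq_empty_of_im_nonpos hz]

/-! ## §2 The mirror symmetry `vol T(1 − z̄) = vol T(z)` (reflection `x ↦ 1 − x` of `ℍ³`) -/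

/-- The reflection `(x, y, t) ↦ (1 − x, y, t)` of `ℝ³` as a measurable equivalence. [folklore] -/
def mirrorEquiv : (Fin 3 → ℝ) ≃ᵐ (Fin 3 → ℝ) :=
  MeasurableEquiv.piCongrRight fun i : Fin 3 =>
    if i = 0 then MeasurableEquiv.subLeft (1 : ℝ) else MeasurableEquiv.refl ℝ

/-- Auxiliary: `mirrorEquiv_apply`. [folklore] -/
theorem mirrorEquiv_apply (p : Fin 3 → ℝ) (i : Fin 3) :
    mirrorEquiv p i = if i = 0 then 1 - p i else p i := by
  unfold mirrorEquiv
  by_cases h : i = 0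
  · subst h; simp [MeasurableEquiv.piCongrRight, MeasurableEquiv.subLeft]
  · simp [MeasurableEquiv.piCongrRight, h]

/-- Auxiliary: `mirrorEquiv_apply_zero`. [folklore] -/
@[simp] theorem mirrorEquiv_apply_zero (p : Fin 3 → ℝ) : mirrorEquiv p 0 = 1 - p 0 := by
  rw [mirrorEquiv_apply]; rfl

/-- Auxiliary: `mirrorEquiv_apply_one`. [folklore] -/
@[simp] theorem mirrorEquiv_apply_one (p : Fin 3 → ℝ) : mirrorEquiv p 1 = p 1 := by
  rw [mirrorEquiv_apply]; exact if_neg (by decide)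

/-- Auxiliary: `mirrorEquiv_apply_two`. [folklore] -/
@[simp] theorem mirrorEquiv_apply_two (p : Fin 3 → ℝ) : mirrorEquiv p 2 = p 2 := by
  rw [mirrorEquiv_apply]; exact if_neg (by decide)

/-- The coordinate maps of the reflection: `x ↦ 1 − x` in coordinate `0`, identity elsewhere. -/
def mirrorCoord (i : Fin 3) (x : ℝ) : ℝ := if i = 0 then 1 - x else x

/-- Each coordinate map preserves Lebesgue measure on `ℝ`. [folklore] -/
theorem measurePreserving_mirrorCoord (i : Fin 3) :
    MeasurePreserving (mirrorCoord i) (volume : Measure ℝ) volume := by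
  by_cases h : i = 0
  · have e : mirrorCoord i = fun x : ℝ => (1 : ℝ) - x := funext fun x => if_pos h
    rw [e]
    exact Measure.measurePreserving_sub_left volume (1 : ℝ)
  · have e : mirrorCoord i = id := funext fun x => if_neg h
    rw [e]
    exact MeasurePreserving.id volume

/-- The reflection preserves Lebesgue measure on `ℝ³` (product of `x ↦ 1 − x` and identities).
[folklore] -/
theorem measurePreserving_mirrorEquiv : MeasurePreserving mirrorEquiv volume volume := by
  have e : (⇑mirrorEquiv) = fun (a : Fin 3 → ℝ) (i : Fin 3) => mirrorCoord i (a i) := by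
    funext a i
    rw [mirrorEquiv_apply]
    rfl
  rw [e, MeasureTheory.volume_pi]
  exact measurePreserving_pi (fun _ : Fin 3 => (volume : Measure ℝ))
    (fun _ : Fin 3 => (volume : Measure ℝ)) measurePreserving_mirrorCoord

/-- `T(1 − z̄)` is the mirror image of `T(z)` under `x ↦ 1 − x`. [folklore] -/
theorem preimage_mirrorEquiv_idealTetrahedron (z : ℂ) :
    mirrorEquiv ⁻¹' (idealTetrahedron z) = idealTetrahedron (1 - conj z) := by
  ext p
  have hN : Complex.normSq z = z.re * z.re + z.im * z.im := Complex.normSq_apply z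
  have hre : (1 - conj z).re = 1 - z.re := by simp
  have him : (1 - conj z).im = z.im := by simp
  have hN' : Complex.normSq (1 - conj z) = (1 - z.re) * (1 - z.re) + z.im * z.im := by
    rw [Complex.normSq_apply, hre, him]
  simp only [mem_preimage, mem_idealTetrahedron_iff, mirrorEquiv_apply_zero, mirrorEquiv_apply_one,
    mirrorEquiv_apply_two, hre, him, hN', hN]
  have key : z.im * ((1 - p 0) ^ 2 + p 1 ^ 2 + p 2 ^ 2 - (1 - p 0)) +
      (z.re - (z.re * z.re + z.im * z.im)) * p 1 =
      z.im * (p 0 ^ 2 + p 1 ^ 2 + p 2 ^ 2 - p 0) +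
        (1 - z.re - ((1 - z.re) * (1 - z.re) + z.im * z.im)) * p 1 := by ring
  constructor
  · rintro ⟨h1, h2, h3, h4, h5⟩
    refine ⟨h1, by linarith, by linarith, h4, by linarith⟩
  · rintro ⟨h1, h2, h3, h4, h5⟩
    refine ⟨h1, by linarith, by linarith, h4, by linarith⟩

/-- **Mirror symmetry of the volume**: `vol T(1 − z̄) = vol T(z)` for every `z` (no algebraicity,
no sign condition; both sides are junk-free set integrals related by a measure-preserving
reflection). Geometrically: `T(z)` and `T(1 − z̄)` are mirror-image ideal tetrahedra
(`D(1 − z̄) = D(z)`). [folklore] -/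
theorem idealTetrahedronVolume_one_sub_conj (z : ℂ) :
    idealTetrahedronVolume (1 - conj z) = idealTetrahedronVolume z := by
  unfold idealTetrahedronVolume
  rw [← preimage_mirrorEquiv_idealTetrahedron]
  have h := measurePreserving_mirrorEquiv.setIntegral_preimage_emb mirrorEquiv.measurableEmbedding
    (fun p : Fin 3 → ℝ => 1 / p 2 ^ 3) (idealTetrahedron z)
  simpa using h

/-! ## §3 Load-bearing hypothesis: algebraicity of the points -/

/-! The transcendental point `xL = L + i` (`L = Σ 2^{-k!}` Liouville's constant) and its
non-algebraicity are the tree's (`FiveTermTransferNegative.xL`, `not_isAlgebraic_xL`). -/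

/-- The mirror point `1 − x̄L = (1 − L) + i` differs from `xL` (`L ≠ 1/2`, `L` being
transcendental). [folklore] -/
theorem one_sub_conj_xL_ne : 1 - conj xL ≠ xL := by
  intro e
  have h := congrArg Complex.re e
  simp only [sub_re, one_re, conj_re, xL_re] at h
  have hL : L = (2 : ℝ)⁻¹ := by linarith
  have h2 : IsAlgebraic ℚ ((2 : ℝ)⁻¹) := by
    simpa using (isAlgebraic_nat (R := ℚ) (A := ℝ) 2).inv
  apply not_isAlgebraic_L
  rw [hL]
  exact h2


/-! ### The coefficient functional and the relators -/

/-- Coefficient extraction at `w`: the additive map `ℤ[ℂ] → ℤ`, `[w] ↦ 1`, `[w'] ↦ 0`. [folklore] -/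
def coeffAt (w : ℂ) : FreeAbelianGroup ℂ →+ ℤ :=
  FreeAbelianGroup.lift fun w' => if w' = w then 1 else 0

/-- Auxiliary: `coeffAt_of`. [folklore] -/
@[simp] theorem coeffAt_of (w w' : ℂ) :
    coeffAt w (FreeAbelianGroup.of w') = if w' = w then 1 else 0 := by
  simp [coeffAt]

/-- Auxiliary: `coeffAt_of_ne`. [folklore] -/
theorem coeffAt_of_ne {w w' : ℂ} (h : w' ≠ w) : coeffAt w (FreeAbelianGroup.of w') = 0 := by
  simp [h]

/-- Auxiliary: `coeffAt_of_self`. [folklore] -/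
theorem coeffAt_of_self (w : ℂ) : coeffAt w (FreeAbelianGroup.of w) = 1 := by
  simp

/-- The five arguments of a five-term relator with algebraic `x, y` are algebraic. [folklore] -/
theorem isAlgebraic_fiveTerm_args {x y : ℂ} (hx : IsAlgebraic ℚ x) (hy : IsAlgebraic ℚ y) :
    IsAlgebraic ℚ (y / x) ∧ IsAlgebraic ℚ ((1 - x⁻¹) / (1 - y⁻¹)) ∧
      IsAlgebraic ℚ ((1 - x) / (1 - y)) := by
  have h1 : IsAlgebraic ℚ (1 : ℂ) := by simpa using isAlgebraic_nat (R := ℚ) (A := ℂ) 1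
  refine ⟨?_, ?_, ?_⟩
  · rw [div_eq_mul_inv]; exact hy.mul hx.inv
  · rw [div_eq_mul_inv]; exact (h1.sub hx.inv).mul (h1.sub hy.inv).inv
  · rw [div_eq_mul_inv]; exact (h1.sub hx).mul (h1.sub hy).inv

/-- A transcendental, non-real point has coefficient `0` in every dilogarithm relator (all relator
entries are algebraic or real). [folklore] -/
theorem coeffAt_eq_zero_of_mem_dilogRelators {w : ℂ} (hw : ¬ IsAlgebraic ℚ w) (hwim : w.im ≠ 0)
    {c : FreeAbelianGroup ℂ} (hc : c ∈ dilogRelators) : coeffAt w c = 0 := by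
  have ne : ∀ v : ℂ, IsAlgebraic ℚ v → v ≠ w := fun v hv e => hw (e ▸ hv)
  rcases hc with (⟨x, y, hx, hy, -, -, -, -, -, rfl⟩ | ⟨u, hu, rfl⟩) | ⟨u, hu, rfl⟩
  · obtain ⟨h1, h2, h3⟩ := isAlgebraic_fiveTerm_args hx hy
    simp only [map_add, map_sub, coeffAt_of_ne (ne _ hx), coeffAt_of_ne (ne _ hy),
      coeffAt_of_ne (ne _ h1), coeffAt_of_ne (ne _ h2), coeffAt_of_ne (ne _ h3)]
    norm_num
  · have hu' : IsAlgebraic ℚ (conj u) := hu.algHom (starRingEnd ℂ).toRatAlgHom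
    simp only [map_add, coeffAt_of_ne (ne _ hu), coeffAt_of_ne (ne _ hu'), add_zero]
  · have ne1 : u ≠ w := fun e => hwim (e ▸ hu)
    exact coeffAt_of_ne ne1

/-- Hence it has coefficient `0` in the whole relator subgroup. [folklore] -/
theorem coeffAt_eq_zero_of_mem_closure {w : ℂ} (hw : ¬ IsAlgebraic ℚ w) (hwim : w.im ≠ 0)
    {c : FreeAbelianGroup ℂ} (hc : c ∈ AddSubgroup.closure dilogRelators) : coeffAt w c = 0 := by
  have hle : AddSubgroup.closure dilogRelators ≤ (coeffAt w).ker :=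
    (AddSubgroup.closure_le _).mpr fun c hc => coeffAt_eq_zero_of_mem_dilogRelators hw hwim hc
  exact hle hc

/-- **The crux with the hypothesis `∀ i, IsAlgebraic ℚ (z i)` dropped** (relators unchanged;
Literature names, cf. `crux_iff`). -/
def ZagierWithoutAlgebraic : Prop :=
  ∀ (k : ℕ) (z : Fin k → ℂ) (n : Fin k → ℤ), (∀ i, 0 < (z i).im) →
    ∑ i, (n i : ℝ) * idealTetrahedronVolume (z i) = 0 →
      (∑ i, n i • FreeAbelianGroup.of (z i)) ∈ AddSubgroup.closure dilogRelators

/-- **Any proof must use the algebraicity of the points.** Witness: the mirror pair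
`[L + i] − [(1 − L) + i]` (`L` Liouville's constant) has volume sum `0` (`§2`) but coefficient `1`
at the transcendental point `L + i`, where every relator has coefficient `0`.
(Over `ℂ` the true relation group is the full `𝒫(ℂ)⁺ +` five-term span with COMPLEX entries;
the crux's relators only have algebraic entries.) [folklore] -/
theorem zagier_false_without_algebraic : ¬ ZagierWithoutAlgebraic := by
  intro h
  have him : ∀ i : Fin 2, 0 < ((![xL, 1 - conj xL] : Fin 2 → ℂ) i).im := by
    intro i
    fin_cases i <;> simp
  have hvol : ∑ i : Fin 2, ((![1, -1] : Fin 2 → ℤ) i : ℝ) *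
      idealTetrahedronVolume ((![xL, 1 - conj xL] : Fin 2 → ℂ) i) = 0 := by
    simp [Fin.sum_univ_two, idealTetrahedronVolume_one_sub_conj]
  have hmem := h 2 ![xL, 1 - conj xL] ![1, -1] him hvol
  have h0 := coeffAt_eq_zero_of_mem_closure not_isAlgebraic_xL (by simp) hmem
  simp [Fin.sum_univ_two, coeffAt_of_ne one_sub_conj_xL_ne] at h0

/-! ## §4 Two refuted naive strengthenings (cheap, by the mirror symmetry) -/

/-- Auxiliary: `isAlgebraic_one_add_I`. [folklore] -/
theorem isAlgebraic_one_add_I : IsAlgebraic ℚ (1 + I) :=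
  isAlgebraic_of_eq_rat 1 1 (by simp)

/-- REFUTED STRENGTHENING 1: **the volume is not injective on the algebraic upper half plane**
(so "no non-trivial `ℤ`-relation at all among the `vol T(zᵢ)`" is false): `vol T(i) = vol T(1+i)`,
the two tetrahedra being mirror images. The genuine statement must quotient by relators.
[folklore] -/
theorem not_volume_injective :
    ¬ ∀ z w : ℂ, IsAlgebraic ℚ z → IsAlgebraic ℚ w → 0 < z.im → 0 < w.im →
      idealTetrahedronVolume z = idealTetrahedronVolume w → z = w := by
  intro h
  have e : idealTetrahedronVolume (1 + I) = idealTetrahedronVolume I := by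
    simpa using idealTetrahedronVolume_one_sub_conj I
  have := h (1 + I) I isAlgebraic_one_add_I (isAlgebraic_of_eq_rat 0 1 (by push_cast; ring)) (by simp) (by simp) e
  simpa using congrArg Complex.re this

/-- The crux with the FIVE-TERM family deleted from the relators (keeping `[w] + [w̄]` and
`[w]`, `w` real). -/
def ZagierWithoutFiveTerm : Prop :=
  ∀ (k : ℕ) (z : Fin k → ℂ) (n : Fin k → ℤ), (∀ i, IsAlgebraic ℚ (z i)) → (∀ i, 0 < (z i).im) →
    ∑ i, (n i : ℝ) * idealTetrahedronVolume (z i) = 0 →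
      (∑ i, n i • FreeAbelianGroup.of (z i)) ∈ AddSubgroup.closure
        ({c | ∃ w : ℂ, IsAlgebraic ℚ w ∧
            c = FreeAbelianGroup.of w + FreeAbelianGroup.of ((starRingEnd ℂ) w)} ∪
          {c | ∃ w : ℂ, w.im = 0 ∧ c = FreeAbelianGroup.of w})

/-- The signed coefficient functional `[i] ↦ 1`, `[−i] ↦ −1`, else `0`: it kills `[w] + [w̄]`
and `[w]` (`w` real). [folklore] -/
def signedCoeffI : FreeAbelianGroup ℂ →+ ℤ :=
  FreeAbelianGroup.lift fun w => if w = I then 1 else if w = -I then -1 else 0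

/-- Auxiliary: `signedCoeffI_of`. [folklore] -/
@[simp] theorem signedCoeffI_of (w : ℂ) :
    signedCoeffI (FreeAbelianGroup.of w) = if w = I then 1 else if w = -I then -1 else 0 := by
  simp [signedCoeffI]

/-- Auxiliary: `I_ne_neg_I'`. [folklore] -/
theorem neg_I_ne_I : (-I : ℂ) ≠ I := by
  intro e; have := congrArg Complex.im e; norm_num at this

/-- Auxiliary: `signedCoeffI_conj_pair`. [folklore] -/
theorem signedCoeffI_conj_pair (w : ℂ) :
    signedCoeffI (FreeAbelianGroup.of w + FreeAbelianGroup.of (conj w)) = 0 := by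
  rw [map_add, signedCoeffI_of, signedCoeffI_of]
  by_cases h1 : w = I
  · subst h1; simp [neg_I_ne_I]
  · by_cases h2 : w = -I
    · subst h2; simp [neg_I_ne_I]
    · have h3 : conj w ≠ I := fun e => h2 (by rw [← conj_conj w, e]; simp)
      have h4 : conj w ≠ -I := fun e => h1 (by rw [← conj_conj w, e]; simp)
      simp [h1, h2, h3, h4]

/-- Auxiliary: `signedCoeffI_real`. [folklore] -/
theorem signedCoeffI_real {w : ℂ} (hw : w.im = 0) : signedCoeffI (FreeAbelianGroup.of w) = 0 := by
  have h1 : w ≠ I := fun e => by simp [e] at hw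
  have h2 : w ≠ -I := fun e => by simp [e] at hw
  simp [h1, h2]

/-- **Any proof must use the five-term relators**: with only the conjugation and real families,
the mirror relation `vol T(i) = vol T(1 + i)` is not explained — `[i] − [1 + i]` has signed
coefficient `1`. [folklore] -/
theorem zagier_false_without_fiveTerm : ¬ ZagierWithoutFiveTerm := by
  intro h
  have halg : ∀ j : Fin 2, IsAlgebraic ℚ ((![I, 1 + I] : Fin 2 → ℂ) j) := by
    intro j; fin_cases j
    · exact (isAlgebraic_of_eq_rat 0 1 (by push_cast; ring))
    · exact isAlgebraic_one_add_I
  have him : ∀ j : Fin 2, 0 < ((![I, 1 + I] : Fin 2 → ℂ) j).im := by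
    intro j; fin_cases j <;> simp
  have hvol : ∑ j : Fin 2, ((![1, -1] : Fin 2 → ℤ) j : ℝ) *
      idealTetrahedronVolume ((![I, 1 + I] : Fin 2 → ℂ) j) = 0 := by
    have e : idealTetrahedronVolume (1 + I) = idealTetrahedronVolume I := by
      simpa using idealTetrahedronVolume_one_sub_conj I
    simp [Fin.sum_univ_two, e]
  have hmem := h 2 ![I, 1 + I] ![1, -1] halg him hvol
  have hle : AddSubgroup.closure
      ({c | ∃ w : ℂ, IsAlgebraic ℚ w ∧
          c = FreeAbelianGroup.of w + FreeAbelianGroup.of ((starRingEnd ℂ) w)} ∪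
        {c | ∃ w : ℂ, w.im = 0 ∧ c = FreeAbelianGroup.of w}) ≤ signedCoeffI.ker := by
    refine (AddSubgroup.closure_le _).mpr ?_
    rintro c (⟨w, -, rfl⟩ | ⟨w, hw, rfl⟩)
    · exact signedCoeffI_conj_pair w
    · exact signedCoeffI_real hw
  have h0 : signedCoeffI (∑ j : Fin 2, (![1, -1] : Fin 2 → ℤ) j •
      FreeAbelianGroup.of ((![I, 1 + I] : Fin 2 → ℂ) j)) = 0 := hle hmem
  have h1 : (1 + I : ℂ) ≠ I := fun e => by simpa using congrArg Complex.re e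
  have h2 : (1 + I : ℂ) ≠ -I := fun e => by simpa using congrArg Complex.re e
  simp [Fin.sum_univ_two, h1, h2] at h0

/-! ## §5 A Dehn-type invariant `ℤ[ℂ] → ℚ` vanishing on every dilogarithm relator -/

section ext
variable (u : Additive ℂˣ →+ ℚ)

/-- Extension by `0 ↦ 0` of a homomorphism `ℂˣ → ℚ` to a function on `ℂ`. -/
def ext (z : ℂ) : ℚ :=
  if h : z = 0 then 0 else u (Additive.ofMul (Units.mk0 z h))

/-- Auxiliary: `ext_of_ne`. [folklore] -/
theorem ext_of_ne {z : ℂ} (h : z ≠ 0) : ext u z = u (Additive.ofMul (Units.mk0 z h)) := by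
  simp [ext, h]

/-- Auxiliary: `ext_mul`. [folklore] -/
theorem ext_mul {p q : ℂ} (hp : p ≠ 0) (hq : q ≠ 0) : ext u (p * q) = ext u p + ext u q := by
  rw [ext_of_ne u hp, ext_of_ne u hq, ext_of_ne u (mul_ne_zero hp hq), ← map_add, ← ofMul_mul]
  congr 2
  ext
  simp

/-- Auxiliary: `ext_one`. [folklore] -/
theorem ext_one : ext u 1 = 0 := by
  have h := ext_mul u one_ne_zero one_ne_zero
  rw [one_mul] at h
  linarith

/-- Auxiliary: `ext_inv`. [folklore] -/
theorem ext_inv {p : ℂ} (hp : p ≠ 0) : ext u p⁻¹ = -ext u p := by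
  have h := ext_mul u hp (inv_ne_zero hp)
  rw [mul_inv_cancel₀ hp, ext_one] at h
  linarith

/-- Auxiliary: `ext_div`. [folklore] -/
theorem ext_div {p q : ℂ} (hp : p ≠ 0) (hq : q ≠ 0) : ext u (p / q) = ext u p - ext u q := by
  rw [div_eq_mul_inv, ext_mul u hp (inv_ne_zero hq), ext_inv u hq, sub_eq_add_neg]

/-- Auxiliary: `ext_neg_one`. [folklore] -/
theorem ext_neg_one : ext u (-1) = 0 := by
  have h := ext_mul u (p := -1) (q := -1) (by norm_num) (by norm_num)
  rw [neg_one_mul, neg_neg, ext_one] at h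
  linarith

/-- Auxiliary: `ext_neg`. [folklore] -/
theorem ext_neg {p : ℂ} (hp : p ≠ 0) : ext u (-p) = ext u p := by
  rw [← neg_one_mul, ext_mul u (by norm_num) hp, ext_neg_one, zero_add]

/-- `ext u` kills roots of unity: if `p ^ n = 1` (`n ≥ 1`) then `ext u p = 0`. -/
theorem ext_eq_zero_of_pow_eq_one {p : ℂ} {n : ℕ} (hn : n ≠ 0) (h : p ^ n = 1) : ext u p = 0 := by
  have hp : p ≠ 0 := by
    rintro rfl
    rw [zero_pow hn] at h
    exact zero_ne_one h
  have key : ∀ m : ℕ, ext u (p ^ m) = m * ext u p := by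
    intro m
    induction m with
    | zero => simp [ext_one]
    | succ m ih => rw [pow_succ, ext_mul u (pow_ne_zero m hp) hp, ih]; push_cast; ring
  have := key n
  rw [h, ext_one] at this
  have hn' : (n : ℚ) ≠ 0 := Nat.cast_ne_zero.mpr hn
  have : (n : ℚ) * ext u p = 0 := this.symm
  simpa [hn'] using this

/-- The four field identities behind the five-term relation. -/
theorem fiveTerm_args {x y : ℂ} (hx0 : x ≠ 0) (hy0 : y ≠ 0) (hy1 : y ≠ 1) :
    1 - y / x = (x - y) / x ∧
    (1 - x⁻¹) / (1 - y⁻¹) = ((1 - x) * y) / (x * (1 - y)) ∧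
    1 - (1 - x⁻¹) / (1 - y⁻¹) = (x - y) / (x * (1 - y)) ∧
    1 - (1 - x) / (1 - y) = (x - y) / (1 - y) := by
  have hy1' : (1 - y) ≠ 0 := sub_ne_zero.mpr (Ne.symm hy1)
  refine ⟨?_, ?_, ?_, ?_⟩
  · field_simp
  · field_simp
    ring
  · field_simp
    ring
  · field_simp
    ring

/-- Values of `ext u` at the five-term arguments. -/
theorem ext_fiveTerm_args {x y : ℂ} (hx0 : x ≠ 0) (hx1 : x ≠ 1) (hy0 : y ≠ 0) (hy1 : y ≠ 1)
    (hxy : x ≠ y) :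
    ext u (y / x) = ext u y - ext u x ∧
    ext u (1 - y / x) = ext u (x - y) - ext u x ∧
    ext u ((1 - x⁻¹) / (1 - y⁻¹)) = ext u (1 - x) + ext u y - ext u x - ext u (1 - y) ∧
    ext u (1 - (1 - x⁻¹) / (1 - y⁻¹)) = ext u (x - y) - ext u x - ext u (1 - y) ∧
    ext u ((1 - x) / (1 - y)) = ext u (1 - x) - ext u (1 - y) ∧
    ext u (1 - (1 - x) / (1 - y)) = ext u (x - y) - ext u (1 - y) := by
  have hx1' : (1 - x) ≠ 0 := sub_ne_zero.mpr (Ne.symm hx1)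
  have hy1' : (1 - y) ≠ 0 := sub_ne_zero.mpr (Ne.symm hy1)
  have hxy' : x - y ≠ 0 := sub_ne_zero.mpr hxy
  obtain ⟨e1, e2, e3, e4⟩ := fiveTerm_args hx0 hy0 hy1
  refine ⟨ext_div u hy0 hx0, ?_, ?_, ?_, ext_div u hx1' hy1', ?_⟩
  · rw [e1, ext_div u hxy' hx0]
  · rw [e2, ext_div u (mul_ne_zero hx1' hy0) (mul_ne_zero hx0 hy1'), ext_mul u hx1' hy0,
      ext_mul u hx0 hy1']
    ring
  · rw [e3, ext_div u hxy' (mul_ne_zero hx0 hy1'), ext_mul u hx0 hy1']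
    ring
  · rw [e4, ext_div u hxy' hy1']

end ext

section sym
variable (u v : Additive ℂˣ →+ ℚ)

/-- The symbol `φ(z) = u(z)·v(1 − z) − v(z)·u(1 − z)`: an alternating pairing of two additive
characters of `ℂˣ` evaluated on `z ∧ (1 − z)`. -/
def sym (z : ℂ) : ℚ := ext u z * ext v (1 - z) - ext v z * ext u (1 - z)

/-- **The five-term identity for the symbol**, exact for ALL `x ≠ y` in `ℂ ∖ {0, 1}`. -/
theorem sym_fiveTerm {x y : ℂ} (hx0 : x ≠ 0) (hx1 : x ≠ 1) (hy0 : y ≠ 0) (hy1 : y ≠ 1)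
    (hxy : x ≠ y) :
    sym u v x - sym u v y + sym u v (y / x) - sym u v ((1 - x⁻¹) / (1 - y⁻¹)) +
      sym u v ((1 - x) / (1 - y)) = 0 := by
  obtain ⟨a1, a2, a3, a4, a5, a6⟩ := ext_fiveTerm_args u hx0 hx1 hy0 hy1 hxy
  obtain ⟨b1, b2, b3, b4, b5, b6⟩ := ext_fiveTerm_args v hx0 hx1 hy0 hy1 hxy
  simp only [sym]
  rw [a1, a2, a3, a4, a5, a6, b1, b2, b3, b4, b5, b6]
  ring

/-- The anti-symmetrised symbol `ψ(z) = φ(z) − φ(z̄)`. -/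
def asym (z : ℂ) : ℚ := sym u v z - sym u v (conj z)

/-- **The Dehn-type invariant** `δ : ℤ[ℂ] → ℚ`, `[z] ↦ ψ(z)`. -/
def dehn : FreeAbelianGroup ℂ →+ ℚ := FreeAbelianGroup.lift (asym u v)

/-- Auxiliary: `dehn_of`. [folklore] -/
@[simp] theorem dehn_of (z : ℂ) : dehn u v (FreeAbelianGroup.of z) = asym u v z := by
  simp [dehn]

/-- `δ` kills every dilogarithm relator (five-term for all `x ≠ y ∉ {0,1}`, no algebraicity used;
`[w] + [w̄]`; `[w]` real). -/
theorem dehn_eq_zero_of_mem_dilogRelators {c : FreeAbelianGroup ℂ} (hc : c ∈ dilogRelators) :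
    dehn u v c = 0 := by
  rcases hc with (⟨x, y, -, -, hx0, hx1, hy0, hy1, hxy, rfl⟩ | ⟨w, -, rfl⟩) | ⟨w, hw, rfl⟩
  · have hx0' : conj x ≠ 0 := (map_ne_zero _).mpr hx0
    have hy0' : conj y ≠ 0 := (map_ne_zero _).mpr hy0
    have hx1' : conj x ≠ 1 := fun e => hx1 (by rw [← conj_conj x, e, map_one])
    have hy1' : conj y ≠ 1 := fun e => hy1 (by rw [← conj_conj y, e, map_one])
    have hxy' : conj x ≠ conj y := fun e => hxy (by rw [← conj_conj x, e, conj_conj])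
    have h1 := sym_fiveTerm u v hx0 hx1 hy0 hy1 hxy
    have h2 := sym_fiveTerm u v hx0' hx1' hy0' hy1' hxy'
    simp only [map_add, map_sub, dehn_of, asym, map_div₀, map_one, map_inv₀]
    linarith
  · simp [asym]
  · have e : conj w = w := Complex.conj_eq_iff_im.mpr hw
    simp [asym, e]

/-- Auxiliary: `dehn_eq_zero_of_mem_closure`. [folklore] -/
theorem dehn_eq_zero_of_mem_closure {c : FreeAbelianGroup ℂ}
    (hc : c ∈ AddSubgroup.closure dilogRelators) : dehn u v c = 0 := by
  have hle : AddSubgroup.closure dilogRelators ≤ (dehn u v).ker :=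
    (AddSubgroup.closure_le _).mpr fun c hc => dehn_eq_zero_of_mem_dilogRelators u v hc
  exact hle hc

end sym


/-! ### Additive characters of `ℂˣ` with prescribed values (injectivity of `ℚ`) -/

/-- **Extension lemma.** If no relation `a • x₀ + b • x₁ = 0` has `a ≠ 0`, there is an additive
map `φ : X → ℚ` with `φ x₀ = 1`, `φ x₁ = 0` (define it on the line through the image of `x₀` in
`X ⧸ ℤx₁` and extend by the injectivity of the divisible group `ℚ`, `Module.Baer.of_divisible`).
[folklore] -/
theorem exists_addMonoidHom_eq_one_eq_zero {X : Type*} [AddCommGroup X] (x₀ x₁ : X)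
    (hx : ∀ a b : ℤ, a • x₀ + b • x₁ = 0 → a = 0) :
    ∃ φ : X →+ ℚ, φ x₀ = 1 ∧ φ x₁ = 0 := by
  let N : Submodule ℤ X := Submodule.span ℤ {x₁}
  have hx' : ∀ M : ℤ, M • x₀ ∈ N → M = 0 := by
    intro M hM
    obtain ⟨b, hb⟩ := Submodule.mem_span_singleton.mp hM
    refine hx M (-b) ?_
    rw [neg_smul, ← hb, add_neg_cancel]
  have H : ∀ c : ℤ, c • (N.mkQ x₀) = 0 → (RingHom.id ℤ) c • (1 : ℚ) = 0 := by
    intro c hc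
    have hc' : N.mkQ (c • x₀) = 0 := by rw [map_zsmul]; exact hc
    rw [Submodule.mkQ_apply, Submodule.Quotient.mk_eq_zero] at hc'
    rw [hx' c hc', RingHom.id_apply, zero_smul]
  have hmem : N.mkQ x₀ ∈ (LinearPMap.mkSpanSingleton' (N.mkQ x₀) (1 : ℚ) H).domain :=
    Submodule.mem_span_singleton_self _
  obtain ⟨ψ, hψ⟩ := (Module.Baer.of_divisible ℚ).extension_property _
    (LinearPMap.mkSpanSingleton' (N.mkQ x₀) (1 : ℚ) H).domain.injective_subtype
    (LinearPMap.mkSpanSingleton' (N.mkQ x₀) (1 : ℚ) H).toFun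
  refine ⟨(ψ ∘ₗ N.mkQ).toAddMonoidHom, ?_, ?_⟩
  · change ψ (N.mkQ x₀) = 1
    have e := DFunLike.congr_fun hψ ⟨N.mkQ x₀, hmem⟩
    rw [LinearMap.comp_apply, Submodule.subtype_apply] at e
    rw [e]
    exact LinearPMap.mkSpanSingleton'_apply_self _ (1 : ℚ) H hmem
  · change ψ (N.mkQ x₁) = 0
    rw [Submodule.mkQ_apply, (Submodule.Quotient.mk_eq_zero N).2 (Submodule.subset_span rfl),
      map_zero]

/-- Reading an additive relation in `Additive ℂˣ` as a multiplicative one in `ℂ`. [folklore] -/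
theorem zpow_mul_zpow_eq_one_of_smul {w q : ℂ} (hw : w ≠ 0) (hq : q ≠ 0) {a b : ℤ}
    (H : a • Additive.ofMul (Units.mk0 w hw) + b • Additive.ofMul (Units.mk0 q hq) = 0) :
    w ^ a * q ^ b = 1 := by
  have e := congrArg (fun t : Additive ℂˣ => ((Additive.toMul t : ℂˣ) : ℂ)) H
  simpa [toMul_add, toMul_zsmul, Units.val_zpow_eq_zpow_val] using e

/-! ### The witness `q = (2 + i)/(2 − i) = (3 + 4i)/5` and `z₀ = 1 − q = (2 − 4i)/5` -/

/-- `q = (2 + i)/(2 − i)`, a unimodular Gaussian rational which is not a root of unity. -/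
def q : ℂ := (2 + I) / (2 - I)

/-- Auxiliary: `two_add_I_ne_zero`. [folklore] -/
theorem two_add_I_ne_zero : (2 + I : ℂ) ≠ 0 := fun e => by simpa using congrArg Complex.re e
/-- Auxiliary: `two_sub_I_ne_zero`. [folklore] -/
theorem two_sub_I_ne_zero : (2 - I : ℂ) ≠ 0 := fun e => by simpa using congrArg Complex.re e

/-- Auxiliary: `q_ne_zero`. [folklore] -/
theorem q_ne_zero : q ≠ 0 := div_ne_zero two_add_I_ne_zero two_sub_I_ne_zero

/-- Auxiliary: `q_eq`. [folklore] -/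
theorem q_eq : q = (3 + 4 * I) / 5 := by
  unfold q
  rw [div_eq_div_iff two_sub_I_ne_zero (by norm_num)]
  ring_nf
  rw [I_sq]
  ring

/-- Auxiliary: `q_re`. [folklore] -/
theorem q_re : q.re = 3 / 5 := by
  rw [q_eq]; simp
/-- Auxiliary: `q_im`. [folklore] -/
theorem q_im : q.im = 4 / 5 := by
  rw [q_eq]; simp

/-- Auxiliary: `conj_two_add_I`. [folklore] -/
theorem conj_two_add_I : conj (2 + I : ℂ) = 2 - I := by
  rw [map_add, map_ofNat, Complex.conj_I, ← sub_eq_add_neg]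
/-- Auxiliary: `conj_two_sub_I`. [folklore] -/
theorem conj_two_sub_I : conj (2 - I : ℂ) = 2 + I := by
  rw [map_sub, map_ofNat, Complex.conj_I, sub_neg_eq_add]

/-- Auxiliary: `norm_q`. [folklore] -/
theorem norm_q : ‖q‖ = 1 := by
  unfold q
  rw [norm_div, ← conj_two_add_I, Complex.norm_conj, div_self]
  exact norm_ne_zero_iff.mpr two_add_I_ne_zero

/-- Auxiliary: `conj_q`. [folklore] -/
theorem conj_q : conj q = q⁻¹ := by
  unfold q
  rw [map_div₀, conj_two_add_I, conj_two_sub_I, inv_div]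

/-- `2 + i` and `2 − i` are coprime Gaussian primes of norm `5`; so `(2+i)^n ≠ (2−i)^n` for
`n ≥ 1`. [folklore] -/
theorem gaussInt_pow_ne {n : ℕ} (hn : n ≠ 0) :
    (⟨2, 1⟩ : GaussianInt) ^ n ≠ (⟨2, -1⟩ : GaussianInt) ^ n := by
  intro e
  have hcop : IsCoprime (⟨2, -1⟩ : GaussianInt) (⟨2, 1⟩ : GaussianInt) :=
    ⟨⟨1, 1⟩, -1, by decide⟩
  have hdvd : (⟨2, -1⟩ : GaussianInt) ∣ (⟨2, 1⟩ : GaussianInt) ^ n := by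
    rw [e]
    exact dvd_pow_self _ hn
  have hunit : IsUnit (⟨2, -1⟩ : GaussianInt) :=
    (hcop.pow_right (n := n)).isUnit_of_dvd' (dvd_refl _) hdvd
  rw [Zsqrtd.isUnit_iff_norm_isUnit, Zsqrtd.norm_def] at hunit
  rcases Int.isUnit_iff.mp hunit with h | h <;> norm_num at h

/-- Auxiliary: `two_add_I_pow_ne`. [folklore] -/
theorem two_add_I_pow_ne {n : ℕ} (hn : n ≠ 0) : (2 + I : ℂ) ^ n ≠ (2 - I) ^ n := by
  intro e
  apply gaussInt_pow_ne hn
  apply GaussianInt.toComplex_injective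
  have h1 : GaussianInt.toComplex (⟨2, 1⟩ : GaussianInt) = 2 + I := by
    rw [GaussianInt.toComplex_def']; push_cast; ring
  have h2 : GaussianInt.toComplex (⟨2, -1⟩ : GaussianInt) = 2 - I := by
    rw [GaussianInt.toComplex_def']; push_cast; ring
  rw [map_pow, map_pow, h1, h2, e]

/-- `q` is not a root of unity: `q ^ b = 1` forces `b = 0` (`b : ℤ`). [folklore] -/
theorem q_zpow_eq_one {b : ℤ} (h : q ^ b = 1) : b = 0 := by
  have key : ∀ n : ℕ, q ^ n = 1 → n = 0 := by
    intro n hn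
    by_contra hne
    apply two_add_I_pow_ne hne
    unfold q at hn
    rw [div_pow, div_eq_one_iff_eq (pow_ne_zero n two_sub_I_ne_zero)] at hn
    exact hn
  rcases Int.natAbs_eq b with hb | hb
  · rw [hb] at h ⊢
    rw [zpow_natCast] at h
    simp [key _ h]
  · rw [hb] at h ⊢
    rw [zpow_neg, zpow_natCast, inv_eq_one] at h
    simp [key _ h]

/-- The witness point `z₀ = 1 − q = (2 − 4i)/5` of the LOWER half plane. -/
def z₀ : ℂ := 1 - q

/-- Auxiliary: `z₀_eq`. [folklore] -/
theorem z₀_eq : z₀ = (2 - 4 * I) / 5 := by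
  rw [z₀, q_eq]; ring

/-- Auxiliary: `z₀_re`. [folklore] -/
theorem z₀_re : z₀.re = 2 / 5 := by rw [z₀, sub_re, one_re, q_re]; norm_num
/-- Auxiliary: `z₀_im`. [folklore] -/
theorem z₀_im : z₀.im = -(4 / 5) := by rw [z₀, sub_im, one_im, q_im]; norm_num

/-- Auxiliary: `z₀_ne_zero`. [folklore] -/
theorem z₀_ne_zero : z₀ ≠ 0 := fun e => by
  have := congrArg Complex.re e; rw [z₀_re] at this; norm_num at this

/-- Auxiliary: `one_sub_z₀`. [folklore] -/
theorem one_sub_z₀ : 1 - z₀ = q := by rw [z₀]; ring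

/-- Auxiliary: `normSq_z₀`. [folklore] -/
theorem normSq_z₀ : Complex.normSq z₀ = 4 / 5 := by
  rw [Complex.normSq_apply, z₀_re, z₀_im]; norm_num

/-- Auxiliary: `norm_z₀_lt_one`. [folklore] -/
theorem norm_z₀_lt_one : ‖z₀‖ < 1 := by
  have h : ‖z₀‖ ^ 2 < 1 := by
    rw [← Complex.normSq_eq_norm_sq, normSq_z₀]; norm_num
  nlinarith [norm_nonneg z₀]

/-- Auxiliary: `norm_z₀_pos`. [folklore] -/
theorem norm_z₀_pos : 0 < ‖z₀‖ := norm_pos_iff.mpr z₀_ne_zero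

/-- Multiplicative independence I: `z₀ ^ a * q ^ b = 1 → a = 0` (take absolute values:
`|q| = 1`, `0 < |z₀| < 1`). [folklore] -/
theorem indep_z₀_q {a b : ℤ} (h : z₀ ^ a * q ^ b = 1) : a = 0 := by
  have e := congrArg (fun w : ℂ => ‖w‖) h
  simp only [norm_mul, norm_zpow, norm_q, one_zpow, mul_one, norm_one] at e
  have hanti : StrictAnti fun n : ℤ => ‖z₀‖ ^ n := zpow_right_strictAnti₀ norm_z₀_pos norm_z₀_lt_one
  have e0 : (fun n : ℤ => ‖z₀‖ ^ n) a = (fun n : ℤ => ‖z₀‖ ^ n) 0 := by simpa using e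
  exact hanti.injective e0

/-- Multiplicative independence II: `q ^ a * z₀ ^ b = 1 → a = 0` (absolute values give `b = 0`,
then `q` is not a root of unity). [folklore] -/
theorem indep_q_z₀ {a b : ℤ} (h : q ^ a * z₀ ^ b = 1) : a = 0 := by
  have hb : b = 0 := indep_z₀_q (a := b) (b := a) (by rw [mul_comm]; exact h)
  subst hb
  rw [zpow_zero, mul_one] at h
  exact q_zpow_eq_one h

/-- The two generators of `Additive ℂˣ` we prescribe values on. -/
def gz : Additive ℂˣ := Additive.ofMul (Units.mk0 z₀ z₀_ne_zero)
/-- Auxiliary definition `gq` (see the module docstring, §5). [folklore] -/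
def gq : Additive ℂˣ := Additive.ofMul (Units.mk0 q q_ne_zero)

/-- An additive character `u` of `ℂˣ` with `u(z₀) = 1`, `u(q) = 0`. -/
theorem exists_u : ∃ u : Additive ℂˣ →+ ℚ, u gz = 1 ∧ u gq = 0 :=
  exists_addMonoidHom_eq_one_eq_zero gz gq fun _ _ H => indep_z₀_q (zpow_mul_zpow_eq_one_of_smul _ _ H)

/-- An additive character `v` of `ℂˣ` with `v(q) = 1` (and `v(z₀) = 0`). -/
theorem exists_v : ∃ v : Additive ℂˣ →+ ℚ, v gq = 1 ∧ v gz = 0 :=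
  exists_addMonoidHom_eq_one_eq_zero gq gz fun _ _ H => indep_q_z₀ (zpow_mul_zpow_eq_one_of_smul _ _ H)

/-- The chosen characters. -/
def uu : Additive ℂˣ →+ ℚ := exists_u.choose
/-- Auxiliary definition `vv` (see the module docstring, §5). [folklore] -/
def vv : Additive ℂˣ →+ ℚ := exists_v.choose

/-- Auxiliary: `ext_uu_z₀`. [folklore] -/
theorem ext_uu_z₀ : ext uu z₀ = 1 := by rw [ext_of_ne uu z₀_ne_zero]; exact exists_u.choose_spec.1
/-- Auxiliary: `ext_uu_q`. [folklore] -/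
theorem ext_uu_q : ext uu q = 0 := by rw [ext_of_ne uu q_ne_zero]; exact exists_u.choose_spec.2
/-- Auxiliary: `ext_vv_q`. [folklore] -/
theorem ext_vv_q : ext vv q = 1 := by rw [ext_of_ne vv q_ne_zero]; exact exists_v.choose_spec.1
/-- Auxiliary: `ext_vv_z₀`. [folklore] -/
theorem ext_vv_z₀ : ext vv z₀ = 0 := by rw [ext_of_ne vv z₀_ne_zero]; exact exists_v.choose_spec.2

/-- **The invariant does not vanish at `z₀`**: `δ[z₀] = 2`. Computation: `1 − z₀ = q`,
`z̄₀ = −z₀/q`, `1 − z̄₀ = q̄ = q⁻¹` (`|q| = 1`), so `ψ(z₀) = 2 (u(z₀) v(q) − v(z₀) u(q)) = 2`.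
[folklore] -/
theorem asym_z₀ : asym uu vv z₀ = 2 := by
  have hc : conj z₀ = -z₀ / q := by
    rw [z₀, map_sub, map_one, conj_q]
    field_simp [q_ne_zero]
    ring
  have hc1 : 1 - conj z₀ = q⁻¹ := by
    rw [z₀, map_sub, map_one, conj_q]; ring
  simp only [asym, sym]
  rw [one_sub_z₀, hc1, hc, ext_div uu (neg_ne_zero.mpr z₀_ne_zero) q_ne_zero,
    ext_div vv (neg_ne_zero.mpr z₀_ne_zero) q_ne_zero, ext_neg uu z₀_ne_zero,
    ext_neg vv z₀_ne_zero, ext_inv uu q_ne_zero, ext_inv vv q_ne_zero,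
    ext_uu_z₀, ext_uu_q, ext_vv_q, ext_vv_z₀]
  norm_num

/-- Hence `δ[z̄₀] = −2` for the mirror point `z̄₀ = (2 + 4i)/5` of the UPPER half plane. -/
theorem asym_conj_z₀ : asym uu vv (conj z₀) = -2 := by
  have h := asym_z₀
  simp only [asym, conj_conj] at h ⊢
  linarith

/-- **`[z₀] ∉` the relator subgroup** (`z₀ = (2 − 4i)/5`, lower half plane). [folklore] -/
theorem of_z₀_not_mem : FreeAbelianGroup.of z₀ ∉ AddSubgroup.closure dilogRelators := by
  intro h
  have := dehn_eq_zero_of_mem_closure uu vv h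
  rw [dehn_of, asym_z₀] at this
  norm_num at this

/-- **`[z̄₀] ∉` the relator subgroup** (`z̄₀ = (2 + 4i)/5`, upper half plane): the relator
subgroup is PROPER even on the algebraic upper half plane — the conclusion of the crux is not
vacuous. [folklore] -/
theorem of_conj_z₀_not_mem :
    FreeAbelianGroup.of (conj z₀) ∉ AddSubgroup.closure dilogRelators := by
  intro h
  have := dehn_eq_zero_of_mem_closure uu vv h
  rw [dehn_of, asym_conj_z₀] at this
  norm_num at this


/-! ## §6 Load-bearing hypotheses certified by the Dehn invariant -/

/-- `z₀` and `z̄₀` are algebraic (Gaussian rationals). [folklore] -/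
theorem isAlgebraic_z₀ : IsAlgebraic ℚ z₀ :=
  isAlgebraic_of_eq_rat (2 / 5) (-(4 / 5)) (by rw [z₀_eq]; push_cast; ring)

/-- Auxiliary: `isAlgebraic_conj_z₀`. [folklore] -/
theorem isAlgebraic_conj_z₀ : IsAlgebraic ℚ (conj z₀) :=
  isAlgebraic_z₀.algHom (starRingEnd ℂ).toRatAlgHom

/-- Auxiliary: `conj_z₀_im`. [folklore] -/
theorem conj_z₀_im : (conj z₀).im = 4 / 5 := by rw [conj_im, z₀_im, neg_neg]

/-- **The crux with the hypothesis `∀ i, 0 < Im (z i)` dropped.** -/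
def ZagierWithoutPosIm : Prop :=
  ∀ (k : ℕ) (z : Fin k → ℂ) (n : Fin k → ℤ), (∀ i, IsAlgebraic ℚ (z i)) →
    ∑ i, (n i : ℝ) * idealTetrahedronVolume (z i) = 0 →
      (∑ i, n i • FreeAbelianGroup.of (z i)) ∈ AddSubgroup.closure dilogRelators

/-- **Any proof must use `0 < Im zᵢ`.** Witness `k = 1`, `z = z₀ = (2 − 4i)/5`, `n = 1`:
`T(z₀) = ∅` (§1) so the volume hypothesis holds, but `δ[z₀] = 2 ≠ 0` while `δ` kills the relator
subgroup. (Lower-half-plane parameters must enter with the sign `B(w̄) = −B(w)`.) [folklore] -/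
theorem zagier_false_without_posIm : ¬ ZagierWithoutPosIm := by
  intro h
  have hvol : ∑ i : Fin 1, ((![1] : Fin 1 → ℤ) i : ℝ) *
      idealTetrahedronVolume ((![z₀] : Fin 1 → ℂ) i) = 0 := by
    simp [idealTetrahedronVolume_eq_zero_of_im_nonpos (z := z₀) (by rw [z₀_im]; norm_num)]
  have hmem := h 1 ![z₀] ![1] (fun i => by fin_cases i; exact isAlgebraic_z₀) hvol
  exact of_z₀_not_mem (by simpa using hmem)

/-- **The crux with the volume hypothesis dropped** ("every formal combination of algebraic
upper-half-plane points is in the relator span"). -/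
def ZagierWithoutVolumeHyp : Prop :=
  ∀ (k : ℕ) (z : Fin k → ℂ) (n : Fin k → ℤ), (∀ i, IsAlgebraic ℚ (z i)) → (∀ i, 0 < (z i).im) →
    (∑ i, n i • FreeAbelianGroup.of (z i)) ∈ AddSubgroup.closure dilogRelators

/-- **The conclusion is not vacuous / any proof must use the volume hypothesis**: the relator
subgroup is a PROPER subgroup on the algebraic upper half plane — `[(2 + 4i)/5]` is not in it
(`δ = −2`). [folklore] -/
theorem zagier_false_without_volumeHyp : ¬ ZagierWithoutVolumeHyp := by
  intro h
  have hmem := h 1 ![conj z₀] ![1] (fun i => by fin_cases i; exact isAlgebraic_conj_z₀)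
    (fun i => by fin_cases i; show 0 < (conj z₀).im; rw [conj_z₀_im]; norm_num)
  exact of_conj_z₀_not_mem (by simpa using hmem)

/-! ## §7 Strength: the crux proves an open irrationality statement -/

/-- The Dehn invariant vanishes at `i` (`i` and `−i` are roots of unity, `1 ∓ i` do not matter):
`[i]` is a genuine Bloch-group element. [folklore] -/
theorem asym_I : asym uu vv I = 0 := by
  have hI : ext uu I = 0 := ext_eq_zero_of_pow_eq_one uu (n := 4) (by norm_num) (by simp)
  have hI' : ext vv I = 0 := ext_eq_zero_of_pow_eq_one vv (n := 4) (by norm_num) (by simp)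
  have h4 : (-I : ℂ) ^ 4 = 1 := by rw [neg_pow I 4]; norm_num
  have hnI : ext uu (-I) = 0 := ext_eq_zero_of_pow_eq_one uu (n := 4) (by norm_num) h4
  have hnI' : ext vv (-I) = 0 := ext_eq_zero_of_pow_eq_one vv (n := 4) (by norm_num) h4
  simp [asym, sym, hI, hI', hnI, hnI']

/-- **What any proof of the crux would prove**: `vol T((2+4i)/5)` and `vol T(i)` (= Catalan's
constant `G = D(i)`) are `ℤ`-linearly independent, i.e. `D((2+4i)/5) / G ∉ ℚ` — an open
irrationality statement (Neumann 1998 §1: "it is not known if a single one of them is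
[irrational]"). Proof: a relation `a·vol + b·G = 0` would put `a[(2+4i)/5] + b[i]` in the relator
span; `δ` gives `−2a + 0 = 0`, then `b·G = 0` with `G > 0`.
[cite: Neumann1998, §1 (discussion after Conjecture 1.5)] -/
theorem crux_implies_indep (hZ : ZagierDilogarithmConjecture) (a b : ℤ)
    (hab : (a : ℝ) * idealTetrahedronVolume (conj z₀) + (b : ℝ) * idealTetrahedronVolume I = 0) :
    a = 0 ∧ b = 0 := by
  have hZ' := crux_iff.mp hZ
  have halg : ∀ j : Fin 2, IsAlgebraic ℚ ((![conj z₀, I] : Fin 2 → ℂ) j) := by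
    intro j; fin_cases j
    · exact isAlgebraic_conj_z₀
    · exact (isAlgebraic_of_eq_rat 0 1 (by push_cast; ring))
  have him : ∀ j : Fin 2, 0 < ((![conj z₀, I] : Fin 2 → ℂ) j).im := by
    intro j; fin_cases j
    · show 0 < (conj z₀).im; rw [conj_z₀_im]; norm_num
    · simp
  have hvol : ∑ j : Fin 2, ((![a, b] : Fin 2 → ℤ) j : ℝ) *
      idealTetrahedronVolume ((![conj z₀, I] : Fin 2 → ℂ) j) = 0 := by
    simpa [Fin.sum_univ_two] using hab
  have hmem := hZ' 2 ![conj z₀, I] ![a, b] halg him hvol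
  have h0 := dehn_eq_zero_of_mem_closure uu vv hmem
  have h1 : dehn uu vv (∑ j : Fin 2, (![a, b] : Fin 2 → ℤ) j •
      FreeAbelianGroup.of ((![conj z₀, I] : Fin 2 → ℂ) j)) =
      a • asym uu vv (conj z₀) + b • asym uu vv I := by
    rw [Fin.sum_univ_two]
    simp only [Matrix.cons_val_zero, Matrix.cons_val_one, Matrix.cons_val_fin_one, map_add,
      map_zsmul, dehn_of]
  rw [h1, asym_conj_z₀, asym_I, smul_zero, add_zero, zsmul_eq_mul] at h0
  have ha : a = 0 := by
    have : (a : ℚ) = 0 := by linarith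
    exact_mod_cast this
  subst ha
  refine ⟨rfl, ?_⟩
  have hG : 0 < idealTetrahedronVolume I := idealTetrahedronVolume_pos (by simp)
  have : (b : ℝ) * idealTetrahedronVolume I = 0 := by simpa using hab
  rcases mul_eq_zero.mp this with hb | hb
  · exact_mod_cast hb
  · exact absurd hb hG.ne'

/-! ## §8 The conjugation family `[w] + [w̄]` is load-bearing (cycle 2) -/

/-! ### Characters vanishing on a subgroup, with one prescribed value -/

/-- **Extension lemma, subgroup form.** If no non-zero multiple of `x₀` lies in the submodule
`N`, there is an additive map `φ : X → ℚ` with `φ(N) = 0` and `φ x₀ = 1` (line through the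
image of `x₀` in `X ⧸ N`, extended by the injectivity of `ℚ`; verbatim the tree's
`WeightClassCharacters.exists_addMonoidHom_eq_one_of_forall_smul_notMem`). [folklore] -/
theorem exists_addMonoidHom_eq_one_of_forall_smul_notMem {X : Type*} [AddCommGroup X]
    (N : Submodule ℤ X) (x₀ : X) (hx : ∀ M : ℤ, M • x₀ ∈ N → M = 0) :
    ∃ φ : X →+ ℚ, (∀ y ∈ N, φ y = 0) ∧ φ x₀ = 1 := by
  have H : ∀ c : ℤ, c • (N.mkQ x₀) = 0 → (RingHom.id ℤ) c • (1 : ℚ) = 0 := by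
    intro c hc
    have hc' : N.mkQ (c • x₀) = 0 := by rw [map_zsmul]; exact hc
    rw [Submodule.mkQ_apply, Submodule.Quotient.mk_eq_zero] at hc'
    rw [hx c hc', RingHom.id_apply, zero_smul]
  have hmem : N.mkQ x₀ ∈ (LinearPMap.mkSpanSingleton' (N.mkQ x₀) (1 : ℚ) H).domain :=
    Submodule.mem_span_singleton_self _
  obtain ⟨ψ, hψ⟩ := (Module.Baer.of_divisible ℚ).extension_property _
    (LinearPMap.mkSpanSingleton' (N.mkQ x₀) (1 : ℚ) H).domain.injective_subtype
    (LinearPMap.mkSpanSingleton' (N.mkQ x₀) (1 : ℚ) H).toFun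
  refine ⟨(ψ ∘ₗ N.mkQ).toAddMonoidHom, fun y hy => ?_, ?_⟩
  · change ψ (N.mkQ y) = 0
    rw [Submodule.mkQ_apply, (Submodule.Quotient.mk_eq_zero N).2 hy, map_zero]
  · change ψ (N.mkQ x₀) = 1
    have e := DFunLike.congr_fun hψ ⟨N.mkQ x₀, hmem⟩
    rw [LinearMap.comp_apply, Submodule.subtype_apply] at e
    rw [e]
    exact LinearPMap.mkSpanSingleton'_apply_self _ (1 : ℚ) H hmem

/-- The positive reals as an additive subgroup of `Additive ℂˣ`. -/
def posRealSubgroup : AddSubgroup (Additive ℂˣ) where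
  carrier := {x | ∃ r : ℝ, 0 < r ∧ ((Additive.toMul x : ℂˣ) : ℂ) = r}
  add_mem' := by
    rintro x y ⟨r, hr, hx⟩ ⟨s, hs, hy⟩
    refine ⟨r * s, mul_pos hr hs, ?_⟩
    rw [toMul_add, Units.val_mul, hx, hy]; push_cast; ring
  zero_mem' := ⟨1, one_pos, by simp⟩
  neg_mem' := by
    rintro x ⟨r, hr, hx⟩
    refine ⟨r⁻¹, inv_pos.mpr hr, ?_⟩
    rw [toMul_neg, Units.val_inv_eq_inv_val, hx]; push_cast; ring

/-- The positive reals as a `ℤ`-submodule of `Additive ℂˣ`. -/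
def posRealSubmodule : Submodule ℤ (Additive ℂˣ) := posRealSubgroup.toIntSubmodule

/-- Auxiliary: `mem_posRealSubmodule`. [folklore] -/
theorem mem_posRealSubmodule {x : Additive ℂˣ} :
    x ∈ posRealSubmodule ↔ ∃ r : ℝ, 0 < r ∧ ((Additive.toMul x : ℂˣ) : ℂ) = r := Iff.rfl

/-- Auxiliary: `ofMul_mk0_mem_posRealSubmodule`. [folklore] -/
theorem ofMul_mk0_mem_posRealSubmodule {r : ℝ} (hr : 0 < r) :
    Additive.ofMul (Units.mk0 (r : ℂ) (by exact_mod_cast hr.ne')) ∈ posRealSubmodule :=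
  ⟨r, hr, by simp⟩

/-- A character killing `posRealSubmodule` kills every positive real. [folklore] -/
theorem ext_ofReal_eq_zero {u : Additive ℂˣ →+ ℚ} (hu : ∀ y ∈ posRealSubmodule, u y = 0)
    {r : ℝ} (hr : 0 < r) : ext u (r : ℂ) = 0 := by
  rw [ext_of_ne u (by exact_mod_cast hr.ne')]
  exact hu _ (ofMul_mk0_mem_posRealSubmodule hr)

/-- … hence every real number. [folklore] -/
theorem ext_eq_zero_of_im_eq_zero {u : Additive ℂˣ →+ ℚ} (hu : ∀ y ∈ posRealSubmodule, u y = 0)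
    {w : ℂ} (hw : w.im = 0) : ext u w = 0 := by
  have e : w = (w.re : ℂ) := by
    apply Complex.ext <;> simp [hw]
  rcases lt_trichotomy w.re 0 with h | h | h
  · have e' : w = -((-w.re : ℝ) : ℂ) := by rw [e]; push_cast; simp
    rw [e', ext_neg u (by exact_mod_cast (neg_pos.mpr h).ne'), ext_ofReal_eq_zero hu (neg_pos.mpr h)]
  · have : w = 0 := by rw [e, h]; simp
    simp [this, ext]
  · rw [e, ext_ofReal_eq_zero hu h]

/-- … and satisfies `u(w̄) = −u(w)`. [folklore] -/
theorem ext_conj {u : Additive ℂˣ →+ ℚ} (hu : ∀ y ∈ posRealSubmodule, u y = 0) (w : ℂ) :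
    ext u (conj w) = -ext u w := by
  by_cases hw : w = 0
  · simp [hw, ext]
  · have hn : (0 : ℝ) < Complex.normSq w := Complex.normSq_pos.mpr hw
    have e : conj w = (Complex.normSq w : ℂ) / w := by
      rw [Complex.normSq_eq_conj_mul_self, mul_div_cancel_right₀ _ hw]
    rw [e, ext_div u (by exact_mod_cast hn.ne') hw, ext_ofReal_eq_zero hu hn, zero_sub]

/-- The plain symbol kills real points when `u, v` vanish on the positive reals. [folklore] -/
theorem sym_eq_zero_of_im_eq_zero {u v : Additive ℂˣ →+ ℚ} (hu : ∀ y ∈ posRealSubmodule, u y = 0)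
    (hv : ∀ y ∈ posRealSubmodule, v y = 0) {w : ℂ} (hw : w.im = 0) : sym u v w = 0 := by
  have hw' : (1 - w).im = 0 := by simp [hw]
  simp [sym, ext_eq_zero_of_im_eq_zero hu hw, ext_eq_zero_of_im_eq_zero hv hw]

/-- The plain symbol is conjugation-invariant when `u, v` vanish on the positive reals.
[folklore] -/
theorem sym_conj {u v : Additive ℂˣ →+ ℚ} (hu : ∀ y ∈ posRealSubmodule, u y = 0)
    (hv : ∀ y ∈ posRealSubmodule, v y = 0) (w : ℂ) : sym u v (conj w) = sym u v w := by
  have e : 1 - conj w = conj (1 - w) := by simp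
  simp only [sym, e, ext_conj hu, ext_conj hv]
  ring

/-- The plain-symbol invariant `ℤ[ℂ] → ℚ`, `[z] ↦ sym u v z`. -/
def psym (u v : Additive ℂˣ →+ ℚ) : FreeAbelianGroup ℂ →+ ℚ := FreeAbelianGroup.lift (sym u v)

/-- Auxiliary: `psym_of`. [folklore] -/
@[simp] theorem psym_of (u v : Additive ℂˣ →+ ℚ) (z : ℂ) :
    psym u v (FreeAbelianGroup.of z) = sym u v z := by
  simp [psym]

/-- The relators of the crux WITHOUT the conjugation family `[w] + [w̄]`. -/
def relatorsWithoutConj : Set (FreeAbelianGroup ℂ) :=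
  {c : FreeAbelianGroup ℂ | ∃ x y : ℂ, IsAlgebraic ℚ x ∧ IsAlgebraic ℚ y ∧ x ≠ 0 ∧ x ≠ 1 ∧
      y ≠ 0 ∧ y ≠ 1 ∧ x ≠ y ∧ c = FreeAbelianGroup.of x - FreeAbelianGroup.of y +
        FreeAbelianGroup.of (y / x) - FreeAbelianGroup.of ((1 - x⁻¹) / (1 - y⁻¹)) +
        FreeAbelianGroup.of ((1 - x) / (1 - y))} ∪
    {c | ∃ w : ℂ, w.im = 0 ∧ c = FreeAbelianGroup.of w}

/-- `psym u v` kills `relatorsWithoutConj` when `u, v` vanish on the positive reals. [folklore] -/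
theorem psym_eq_zero_of_mem_closure {u v : Additive ℂˣ →+ ℚ}
    (hu : ∀ y ∈ posRealSubmodule, u y = 0) (hv : ∀ y ∈ posRealSubmodule, v y = 0)
    {c : FreeAbelianGroup ℂ} (hc : c ∈ AddSubgroup.closure relatorsWithoutConj) :
    psym u v c = 0 := by
  have hle : AddSubgroup.closure relatorsWithoutConj ≤ (psym u v).ker := by
    refine (AddSubgroup.closure_le _).mpr ?_
    rintro c (⟨x, y, -, -, hx0, hx1, hy0, hy1, hxy, rfl⟩ | ⟨w, hw, rfl⟩)
    · have h1 := sym_fiveTerm u v hx0 hx1 hy0 hy1 hxy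
      simp only [SetLike.mem_coe, AddMonoidHom.mem_ker, map_add, map_sub, psym_of]
      exact h1
    · simp only [SetLike.mem_coe, AddMonoidHom.mem_ker, psym_of]
      exact sym_eq_zero_of_im_eq_zero hu hv hw
  exact hle hc

/-! ### The witness `z₁ = 4 + i`, `1 − z₁ = −(3 + i)`; `z₁/z̄₁ = q₁₇`, `(1−z₁)/(1−z̄₁) = i q⁻¹` -/

/-- `q₁₇ = (4 + i)/(4 − i)`. -/
def q₁₇ : ℂ := (4 + I) / (4 - I)

/-- Auxiliary: `four_add_I_ne_zero`. [folklore] -/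
theorem four_add_I_ne_zero : (4 + I : ℂ) ≠ 0 := fun e => by simpa using congrArg Complex.re e
/-- Auxiliary: `four_sub_I_ne_zero`. [folklore] -/
theorem four_sub_I_ne_zero : (4 - I : ℂ) ≠ 0 := fun e => by simpa using congrArg Complex.re e
/-- Auxiliary: `q₁₇_ne_zero`. [folklore] -/
theorem q₁₇_ne_zero : q₁₇ ≠ 0 := div_ne_zero four_add_I_ne_zero four_sub_I_ne_zero

/-- In `ℤ[i]`, `4 + i` is coprime to `4 − i`, `2 + i` and `2 − i` (Bezout). [folklore] -/
theorem gaussInt_coprime :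
    IsCoprime (⟨4, 1⟩ : GaussianInt) ⟨4, -1⟩ ∧ IsCoprime (⟨4, 1⟩ : GaussianInt) ⟨2, -1⟩ ∧
      IsCoprime (⟨4, 1⟩ : GaussianInt) ⟨2, 1⟩ :=
  ⟨⟨⟨2, -1⟩, -2, by decide⟩, ⟨1, ⟨-1, -1⟩, by decide⟩, ⟨⟨0, 1⟩, ⟨0, -2⟩, by decide⟩⟩

/-- `(4+i)^a (2∓i)^c ≠ (4−i)^a (2±i)^c` in `ℤ[i]` for `a ≥ 1`. [folklore] -/
theorem gaussInt_pow_mul_pow_ne {a c : ℕ} (ha : a ≠ 0) (s : Bool) :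
    (⟨4, 1⟩ : GaussianInt) ^ a * (if s then ⟨2, 1⟩ else ⟨2, -1⟩) ^ c ≠
      (⟨4, -1⟩ : GaussianInt) ^ a * (if s then ⟨2, -1⟩ else ⟨2, 1⟩) ^ c := by
  intro e
  obtain ⟨h1, h2, h3⟩ := gaussInt_coprime
  have hdvd : (⟨4, 1⟩ : GaussianInt) ∣ (⟨4, -1⟩ : GaussianInt) ^ a *
      (if s then ⟨2, -1⟩ else ⟨2, 1⟩) ^ c := by
    rw [← e]
    exact Dvd.dvd.mul_right (dvd_pow_self _ ha) _
  have hcop : IsCoprime (⟨4, 1⟩ : GaussianInt)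
      ((⟨4, -1⟩ : GaussianInt) ^ a * (if s then ⟨2, -1⟩ else ⟨2, 1⟩) ^ c) := by
    refine IsCoprime.mul_right h1.pow_right ?_
    cases s
    · simpa using h3.pow_right (n := c)
    · simpa using h2.pow_right (n := c)
  have hunit : IsUnit (⟨4, 1⟩ : GaussianInt) := hcop.isUnit_of_dvd' (dvd_refl _) hdvd
  rw [Zsqrtd.isUnit_iff_norm_isUnit, Zsqrtd.norm_def] at hunit
  rcases Int.isUnit_iff.mp hunit with h | h <;> norm_num at h

/-- Transfer to `ℂ`: `(4+i)^a (2+i)^c ≠ (4−i)^a (2−i)^c` and `(4+i)^a (2−i)^c ≠ (4−i)^a (2+i)^c`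
for `a ≥ 1`. [folklore] -/
theorem complex_pow_mul_pow_ne {a c : ℕ} (ha : a ≠ 0) :
    (4 + I : ℂ) ^ a * (2 + I) ^ c ≠ (4 - I) ^ a * (2 - I) ^ c ∧
      (4 + I : ℂ) ^ a * (2 - I) ^ c ≠ (4 - I) ^ a * (2 + I) ^ c := by
  have t : ∀ (x y : ℤ), GaussianInt.toComplex ⟨x, y⟩ = (x : ℂ) + (y : ℂ) * I := fun x y => by
    rw [GaussianInt.toComplex_def']
  have e41 : GaussianInt.toComplex ⟨4, 1⟩ = 4 + I := by rw [t]; push_cast; ring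
  have e4m : GaussianInt.toComplex ⟨4, -1⟩ = 4 - I := by rw [t]; push_cast; ring
  have e21 : GaussianInt.toComplex ⟨2, 1⟩ = 2 + I := by rw [t]; push_cast; ring
  have e2m : GaussianInt.toComplex ⟨2, -1⟩ = 2 - I := by rw [t]; push_cast; ring
  constructor
  · intro e
    apply gaussInt_pow_mul_pow_ne (c := c) ha true
    apply GaussianInt.toComplex_injective
    simp only [↓reduceIte, map_mul, map_pow, e41, e4m, e21, e2m]
    exact e
  · intro e
    apply gaussInt_pow_mul_pow_ne (c := c) ha false
    apply GaussianInt.toComplex_injective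
    simp only [Bool.false_eq_true, ↓reduceIte, map_mul, map_pow, e41, e4m, e21, e2m]
    exact e

/-- **Multiplicative independence of `q₁₇` and `q`**: `q₁₇ ^ a * q ^ c = 1 → a = 0`. [folklore] -/
theorem indep_q₁₇_q {a c : ℤ} (h : q₁₇ ^ a * q ^ c = 1) : a = 0 := by
  by_contra ha
  -- reduce to a > 0
  wlog hpos : 0 < a generalizing a c
  · have ha' : -a ≠ 0 := neg_ne_zero.mpr ha
    have hneg : 0 < -a := by omega
    refine this (a := -a) (c := -c) ?_ ha' hneg
    rw [zpow_neg, zpow_neg, ← mul_inv, h, inv_one]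
  obtain ⟨n, rfl⟩ := Int.eq_ofNat_of_zero_le hpos.le
  have hn : n ≠ 0 := by omega
  -- clear the denominators (4 - i)^n and (2 ∓ i)^{|c|}
  unfold q₁₇ q at h
  rw [zpow_natCast, div_pow] at h
  rcases Int.natAbs_eq c with hc | hc <;> rw [hc] at h
  · rw [zpow_natCast, div_pow, div_mul_div_comm, div_eq_one_iff_eq
      (mul_ne_zero (pow_ne_zero _ four_sub_I_ne_zero) (pow_ne_zero _ two_sub_I_ne_zero))] at h
    exact (complex_pow_mul_pow_ne (c := c.natAbs) hn).1 h
  · rw [zpow_neg, zpow_natCast, div_pow, inv_div, div_mul_div_comm, div_eq_one_iff_eq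
      (mul_ne_zero (pow_ne_zero _ four_sub_I_ne_zero) (pow_ne_zero _ two_add_I_ne_zero))] at h
    exact (complex_pow_mul_pow_ne (c := c.natAbs) hn).2 h

/-- The witness `z₁ = 4 + i`. -/
def z₁ : ℂ := 4 + I

/-- Auxiliary: `z₁_ne_zero`. [folklore] -/
theorem z₁_ne_zero : z₁ ≠ 0 := four_add_I_ne_zero
/-- Auxiliary: `one_sub_z₁`. [folklore] -/
theorem one_sub_z₁ : 1 - z₁ = -(3 + I) := by rw [z₁]; ring
/-- Auxiliary: `three_add_I_ne_zero`. [folklore] -/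
theorem three_add_I_ne_zero : (3 + I : ℂ) ≠ 0 := fun e => by simpa using congrArg Complex.re e
/-- Auxiliary: `one_sub_z₁_ne_zero`. [folklore] -/
theorem one_sub_z₁_ne_zero : 1 - z₁ ≠ 0 := by rw [one_sub_z₁]; exact neg_ne_zero.mpr three_add_I_ne_zero

/-- `z₁ / z̄₁ = q₁₇`. [folklore] -/
theorem z₁_div_conj : z₁ / conj z₁ = q₁₇ := by
  rw [z₁, q₁₇, map_add, map_ofNat, Complex.conj_I, ← sub_eq_add_neg]

/-- `(1 − z₁)/(1 − z̄₁) = i · q⁻¹`. [folklore] -/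
theorem one_sub_z₁_div_conj : (1 - z₁) / conj (1 - z₁) = I * q⁻¹ := by
  have h1 : conj (1 - z₁) = -(3 - I) := by
    rw [one_sub_z₁, map_neg, map_add, map_ofNat, Complex.conj_I, sub_eq_add_neg]
  have h3 : (3 - I : ℂ) ≠ 0 := fun e => by simpa using congrArg Complex.re e
  rw [h1, one_sub_z₁, neg_div_neg_eq, q, inv_div, mul_div_assoc', div_eq_div_iff h3 two_add_I_ne_zero]
  apply Complex.ext <;> simp <;> norm_num

/-- `(x ^ M) ^ 4 = x ^ (M * 4)` for integer `M`. [folklore] -/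
theorem zpow_pow_four (x : ℂ) (M : ℤ) : (x ^ M) ^ 4 = x ^ (M * 4) := by
  rw [← zpow_natCast (x ^ M) 4, ← zpow_mul]
  norm_cast

/-- `(i ^ b) ^ 4 = 1` for integer `b`. [folklore] -/
theorem I_zpow_pow_four (b : ℤ) : (I ^ b) ^ 4 = 1 := by
  rw [zpow_pow_four, mul_comm, zpow_mul]
  have h4 : (I : ℂ) ^ (4 : ℤ) = 1 := by
    rw [show (4 : ℤ) = ((4 : ℕ) : ℤ) by norm_num, zpow_natCast, Complex.I_pow_four]
  rw [h4, one_zpow]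

/-- Generators of `Additive ℂˣ` at `z₁` and `1 − z₁`. -/
def gz₁ : Additive ℂˣ := Additive.ofMul (Units.mk0 z₁ z₁_ne_zero)
/-- See `gz₁`. -/
def gw₁ : Additive ℂˣ := Additive.ofMul (Units.mk0 (1 - z₁) one_sub_z₁_ne_zero)

/-- Reading `M • [w] ∈ posReal ⊔ ℤ[w']` multiplicatively: `w ^ M = r * w' ^ b`, `r > 0`. [folklore] -/
theorem smul_mem_sup_span {w w' : ℂ} (hw : w ≠ 0) (hw' : w' ≠ 0) {M : ℤ}
    (h : M • Additive.ofMul (Units.mk0 w hw) ∈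
      posRealSubmodule ⊔ Submodule.span ℤ {Additive.ofMul (Units.mk0 w' hw')}) :
    ∃ (r : ℝ) (b : ℤ), 0 < r ∧ w ^ M = r * w' ^ b := by
  rw [Submodule.mem_sup] at h
  obtain ⟨p, hp, y, hy, hpy⟩ := h
  obtain ⟨b, rfl⟩ := Submodule.mem_span_singleton.mp hy
  obtain ⟨r, hr, hpr⟩ := hp
  refine ⟨r, b, hr, ?_⟩
  have e := congrArg (fun t : Additive ℂˣ => ((Additive.toMul t : ℂˣ) : ℂ)) hpy
  simp only [toMul_add, toMul_zsmul, Units.val_mul, Units.val_zpow_eq_zpow_val] at e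
  rw [hpr] at e
  simpa using e.symm

/-- If `w^M = r · w'^b` with `r > 0` then `(w/w̄)^M = (w'/w̄')^b`. [folklore] -/
theorem div_conj_zpow_eq {w w' : ℂ} (hw : w ≠ 0) (hw' : w' ≠ 0) {M b : ℤ} {r : ℝ} (hr : 0 < r)
    (h : w ^ M = r * w' ^ b) : (w / conj w) ^ M = (w' / conj w') ^ b := by
  have hc := congrArg conj h
  simp only [map_zpow₀, map_mul, Complex.conj_ofReal] at hc
  have hr' : (r : ℂ) ≠ 0 := by exact_mod_cast hr.ne'
  have hcw : conj w ≠ 0 := (map_ne_zero _).mpr hw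
  have hcw' : conj w' ≠ 0 := (map_ne_zero _).mpr hw'
  rw [div_zpow, div_zpow, div_eq_div_iff (zpow_ne_zero _ hcw) (zpow_ne_zero _ hcw'), h, hc]
  ring

/-- Condition for `u`: no non-zero multiple of `[z₁]` lies in `posReal ⊔ ℤ[1 − z₁]`. [folklore] -/
theorem smul_gz₁_notMem (M : ℤ)
    (h : M • gz₁ ∈ posRealSubmodule ⊔ Submodule.span ℤ {gw₁}) : M = 0 := by
  obtain ⟨r, b, hr, e⟩ := smul_mem_sup_span z₁_ne_zero one_sub_z₁_ne_zero h
  have e2 := div_conj_zpow_eq z₁_ne_zero one_sub_z₁_ne_zero hr e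
  rw [z₁_div_conj, one_sub_z₁_div_conj, mul_zpow] at e2
  have e4 : (q₁₇ ^ M) ^ 4 = (I ^ b) ^ 4 * (q⁻¹ ^ b) ^ 4 := by rw [← mul_pow, e2]
  rw [I_zpow_pow_four, one_mul, inv_zpow', zpow_pow_four, zpow_pow_four] at e4
  have key : q₁₇ ^ (M * 4) * q ^ (b * 4) = 1 := by
    rw [e4, ← zpow_add₀ q_ne_zero, show -b * 4 + b * 4 = 0 by ring, zpow_zero]
  have := indep_q₁₇_q key
  omega

/-- Condition for `v`: no non-zero multiple of `[1 − z₁]` is a positive real. [folklore] -/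
theorem smul_gw₁_notMem (M : ℤ) (h : M • gw₁ ∈ posRealSubmodule) : M = 0 := by
  obtain ⟨r, hr, e⟩ := h
  have e1 : (1 - z₁) ^ M = r := by
    simpa [gw₁, toMul_zsmul, Units.val_zpow_eq_zpow_val] using e
  have e2 : ((1 - z₁) / conj (1 - z₁)) ^ M = 1 := by
    have hc := congrArg conj e1
    rw [map_zpow₀, Complex.conj_ofReal] at hc
    rw [div_zpow, e1, hc, div_self]
    exact_mod_cast hr.ne'
  rw [one_sub_z₁_div_conj, mul_zpow] at e2
  have e4 : (I ^ M) ^ 4 * (q⁻¹ ^ M) ^ 4 = 1 := by rw [← mul_pow, e2, one_pow]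
  rw [I_zpow_pow_four, one_mul, inv_zpow', zpow_pow_four] at e4
  have := q_zpow_eq_one e4
  omega

/-- The characters: `u₁` kills the positive reals and `1 − z₁`, `u₁(z₁) = 1`; `v₁` kills the
positive reals, `v₁(1 − z₁) = 1`. [folklore] -/
theorem exists_u₁ : ∃ u : Additive ℂˣ →+ ℚ,
    (∀ y ∈ posRealSubmodule, u y = 0) ∧ u gw₁ = 0 ∧ u gz₁ = 1 := by
  obtain ⟨φ, h0, h1⟩ := exists_addMonoidHom_eq_one_of_forall_smul_notMem
    (posRealSubmodule ⊔ Submodule.span ℤ {gw₁}) gz₁ smul_gz₁_notMem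
  exact ⟨φ, fun y hy => h0 y (Submodule.mem_sup_left hy),
    h0 _ (Submodule.mem_sup_right (Submodule.subset_span rfl)), h1⟩

/-- See `exists_u₁`. [folklore] -/
theorem exists_v₁ : ∃ v : Additive ℂˣ →+ ℚ, (∀ y ∈ posRealSubmodule, v y = 0) ∧ v gw₁ = 1 := by
  obtain ⟨φ, h0, h1⟩ := exists_addMonoidHom_eq_one_of_forall_smul_notMem posRealSubmodule gw₁
    smul_gw₁_notMem
  exact ⟨φ, h0, h1⟩

/-- The chosen characters. -/
def u₁ : Additive ℂˣ →+ ℚ := exists_u₁.choose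
/-- See `u₁`. -/
def v₁ : Additive ℂˣ →+ ℚ := exists_v₁.choose

/-- Auxiliary: `u₁_pos`. [folklore] -/
theorem u₁_pos : ∀ y ∈ posRealSubmodule, u₁ y = 0 := exists_u₁.choose_spec.1
/-- Auxiliary: `v₁_pos`. [folklore] -/
theorem v₁_pos : ∀ y ∈ posRealSubmodule, v₁ y = 0 := exists_v₁.choose_spec.1
/-- Auxiliary: `ext_u₁_w₁`. [folklore] -/
theorem ext_u₁_w₁ : ext u₁ (1 - z₁) = 0 := by
  rw [ext_of_ne u₁ one_sub_z₁_ne_zero]; exact exists_u₁.choose_spec.2.1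
/-- Auxiliary: `ext_u₁_z₁`. [folklore] -/
theorem ext_u₁_z₁ : ext u₁ z₁ = 1 := by
  rw [ext_of_ne u₁ z₁_ne_zero]; exact exists_u₁.choose_spec.2.2
/-- Auxiliary: `ext_v₁_w₁`. [folklore] -/
theorem ext_v₁_w₁ : ext v₁ (1 - z₁) = 1 := by
  rw [ext_of_ne v₁ one_sub_z₁_ne_zero]; exact exists_v₁.choose_spec.2

/-- `sym u₁ v₁ z₁ = 1`. [folklore] -/
theorem sym_z₁ : sym u₁ v₁ z₁ = 1 := by
  simp [sym, ext_u₁_z₁, ext_u₁_w₁, ext_v₁_w₁]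

/-- **The mirror element `[4 + i] − [−3 + i]` is outside the span of the five-term and real
relators**: the conjugation family `[w] + [w̄]` of the crux is load-bearing. [folklore] -/
theorem mirror_not_mem_closure_relatorsWithoutConj :
    FreeAbelianGroup.of z₁ - FreeAbelianGroup.of (1 - conj z₁) ∉
      AddSubgroup.closure relatorsWithoutConj := by
  intro h
  have h0 := psym_eq_zero_of_mem_closure u₁_pos v₁_pos h
  rw [map_sub, psym_of, psym_of] at h0
  have e : sym u₁ v₁ (1 - conj z₁) = -sym u₁ v₁ z₁ := by
    have h1 : 1 - conj z₁ = conj (1 - z₁) := by simp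
    rw [h1, sym_conj u₁_pos v₁_pos]
    simp only [sym, sub_sub_cancel]
    ring
  rw [e, sym_z₁] at h0
  norm_num at h0


/-! ### The crux without the conjugation family is FALSE -/

/-- **The crux with the relator family `[w] + [w̄]` (`w` algebraic) deleted** (five-term and
real relators kept). -/
def ZagierWithoutConjFamily : Prop :=
  ∀ (k : ℕ) (z : Fin k → ℂ) (n : Fin k → ℤ), (∀ i, IsAlgebraic ℚ (z i)) → (∀ i, 0 < (z i).im) →
    ∑ i, (n i : ℝ) * idealTetrahedronVolume (z i) = 0 →
      (∑ i, n i • FreeAbelianGroup.of (z i)) ∈ AddSubgroup.closure relatorsWithoutConj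

/-- Auxiliary: `isAlgebraic_z₁`. [folklore] -/
theorem isAlgebraic_z₁ : IsAlgebraic ℚ z₁ := isAlgebraic_of_eq_rat 4 1 (by rw [z₁]; push_cast; ring)

/-- Auxiliary: `isAlgebraic_one_sub_conj_z₁`. [folklore] -/
theorem isAlgebraic_one_sub_conj_z₁ : IsAlgebraic ℚ (1 - conj z₁) :=
  isAlgebraic_of_eq_rat (-3) 1 (by rw [z₁, map_add, map_ofNat, Complex.conj_I]; push_cast; ring)

/-- **Any proof must use the conjugation relators `[w] + [w̄]`**: with only the five-term and
real families, the mirror relation `vol T(4 + i) = vol T(−3 + i)` is unexplained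
(`mirror_not_mem_closure_relatorsWithoutConj`). Together with `zagier_false_without_fiveTerm`
(Part I) this shows the two non-trivial relator families are both needed; dropping the real family
alone is not settled here (it is redundant up to 2-torsion: `2[r] = [r] + [r̄]`). [folklore] -/
theorem zagier_false_without_conjFamily : ¬ ZagierWithoutConjFamily := by
  intro h
  have halg : ∀ j : Fin 2, IsAlgebraic ℚ ((![z₁, 1 - conj z₁] : Fin 2 → ℂ) j) := by
    intro j; fin_cases j
    · exact isAlgebraic_z₁
    · exact isAlgebraic_one_sub_conj_z₁
  have him : ∀ j : Fin 2, 0 < ((![z₁, 1 - conj z₁] : Fin 2 → ℂ) j).im := by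
    intro j; fin_cases j <;> simp [z₁]
  have hvol : ∑ j : Fin 2, ((![1, -1] : Fin 2 → ℤ) j : ℝ) *
      idealTetrahedronVolume ((![z₁, 1 - conj z₁] : Fin 2 → ℂ) j) = 0 := by
    simp [Fin.sum_univ_two, idealTetrahedronVolume_one_sub_conj]
  have hmem := h 2 ![z₁, 1 - conj z₁] ![1, -1] halg him hvol
  apply mirror_not_mem_closure_relatorsWithoutConj
  have e : ∑ j : Fin 2, (![1, -1] : Fin 2 → ℤ) j •
      FreeAbelianGroup.of ((![z₁, 1 - conj z₁] : Fin 2 → ℂ) j) =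
      FreeAbelianGroup.of z₁ - FreeAbelianGroup.of (1 - conj z₁) := by
    rw [Fin.sum_univ_two]
    simp only [Matrix.cons_val_zero, Matrix.cons_val_one, Matrix.cons_val_fin_one, one_smul,
      neg_smul, ← sub_eq_add_neg]
  rw [← e]
  exact hmem

end Summit.KontsevichZagierPeriods.KontsevichZagierPeriods.Cruxes.ZagierDilogarithmConjecture.Disproof

end
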